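import Literature.Computability.MetaComplexity.SumOfSquares

/-!
# PneNP / ExpanderLinearGenerators — counting-frame barrier, SOS half:
pigeonhole frames are refuted by every pseudoexpectation of degree `≥ 2t`
(helper file for stmt-PneNP-11442, `--supports`)

Route `PneNP/ExpanderLinearGenerators`, crux stmt-PneNP-11442
(`Summit.PneNP.PneNP.Theses.ExpanderLinearGenerators.ExpansionForcesDepthFregeSize`). The route's
`why_might_fail` asks whether WPHP-style approximate counting — the one power of bounded-depth
Frege beyond narrow resolution — could certify unsolvability of a structured expanding XOR system
cheaply. A refutation of that kind instantiates a PIGEONHOLE FRAME: polynomials `P i h`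
("pigeon `i` sits in hole `h`", `i < N`, `h < K`, `K < N`) of degree `≤ t` for which the rows
yield Booleanity `P² = P`, hole clash `P i h · P j h = 0` (`i ≠ j`) and totality `Σ_h P i h ≥ 1`.
This file proves the SOS half of the barrier (Grigoriev–Hirsch–Pasechnik's static
Positivstellensatz refutation of PHP, in dual form): **no degree-`d` pseudoexpectation with
`2t ≤ d` validates a pigeonhole frame** — whatever `N > K` are. Combined with the
Grigoriev–Schoenebeck pseudoexpectation of an `(r, c)`-boundary expander (tree:
`Literature.Computability.MetaComplexity.sosFailsToRefute_of_isBoundaryExpander`) this pins the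
expansion scale of any XOR system carrying such a frame to `r = O(t / c)`
(memo `memo-11442-s21-counting-frame-barrier.md` on the item, Theorem III).

* `pseudoexpectation_one_sub_sum_nonneg` — for one hole: `0 ≤ 1 - Σ_i Ẽ[P i h]`
  (expand `Ẽ[(1 - Σ_i P i h)²] ≥ 0` using Booleanity and clash).
* `not_phpFrame_of_isPseudoexpectation` — summing over the `K` holes and using totality over the
  `N` pigeons gives `N ≤ K`; so `K < N` is contradictory.

References: D. Grigoriev, E. A. Hirsch, D. V. Pasechnik, *Complexity of semi-algebraic proofs*,
Moscow Math. J. 2 (2002), §4 (PHP in static LS₊ / Positivstellensatz of bounded degree);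
P. Kothari, R. Mori, R. O'Donnell, D. Witmer, STOC 2017, Def. 2.7–2.8 (pseudoexpectations, the
tree's `IsPseudoexpectation`) [arXiv170104521].
-/

namespace Summit.PneNP.PneNP.Theorems

set_option linter.dupNamespace false -- `Summit.PneNP.PneNP.…`: summit = sub-problem (D-0017)

open Finset MvPolynomial Literature.Computability.MetaComplexity

namespace CountingFrameBarrier

/-- **One hole.** If `Ẽ` is a degree-`d` pseudoexpectation, the `N` polynomials `P i` have
degree `≤ t` with `2t ≤ d`, `Ẽ[P i · P i] = Ẽ[P i]` (Booleanity) and `Ẽ[P i · P j] = 0` for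
`i ≠ j` (clash), then `Σ_i Ẽ[P i] ≤ 1` — the pseudoexpectation "believes" at most one pigeon
sits in the hole. Proof: `0 ≤ Ẽ[(1 - Σ_i P i)²] = 1 - 2Σ_i Ẽ[P i] + Σ_i Ẽ[P i]`.
[Grigoriev–Hirsch–Pasechnik 2002, §4] [folklore] -/
theorem pseudoexpectation_one_sub_sum_nonneg {N d t : ℕ} (Ex : MvPolynomial ℕ ℝ →ₗ[ℝ] ℝ)
    (hE : IsPseudoexpectation d Ex) (P : Fin N → MvPolynomial ℕ ℝ)
    (hdeg : ∀ i, (P i).totalDegree ≤ t) (h2t : 2 * t ≤ d)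
    (hbool : ∀ i, Ex (P i * P i) = Ex (P i))
    (hclash : ∀ i j, i ≠ j → Ex (P i * P j) = 0) :
    0 ≤ 1 - ∑ i, Ex (P i) := by
  classical
  set s : MvPolynomial ℕ ℝ := ∑ i, P i with hs
  -- degree of `1 - s`
  have hsdeg : s.totalDegree ≤ t := totalDegree_finsetSum_le fun i _ => hdeg i
  have hdeg1 : (1 - s).totalDegree ≤ t := by
    refine (totalDegree_sub 1 s).trans ?_
    rw [totalDegree_one]
    exact max_le (Nat.zero_le _) hsdeg
  -- positivity
  have hpos : 0 ≤ Ex ((1 - s) * (1 - s)) := hE.2 _ (by omega)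
  -- `Ẽ[s·s] = Ẽ[s]`
  have hss : Ex (s * s) = Ex s := by
    rw [hs, Finset.sum_mul_sum, map_sum, map_sum]
    refine Finset.sum_congr rfl fun i _ => ?_
    rw [map_sum, Finset.sum_eq_single i]
    · exact hbool i
    · intro j _ hji
      exact hclash i j (Ne.symm hji)
    · intro hi
      exact absurd (Finset.mem_univ i) hi
  have hexpand : (1 - s) * (1 - s) = 1 - 2 * s + s * s := by ring
  rw [hexpand, map_add, map_sub, hss, hE.1] at hpos
  have h2 : Ex (2 * s) = 2 * Ex s := by
    rw [show (2 : MvPolynomial ℕ ℝ) * s = (2 : ℝ) • s by rw [smul_eq_C_mul]; rfl, map_smul,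
      smul_eq_mul]
  rw [h2] at hpos
  have hEs : Ex s = ∑ i, Ex (P i) := by rw [hs, map_sum]
  linarith

/-- **Pigeonhole frames are SOS-cheap to refute, uniformly in `N` and `K`** (dual form). No
degree-`d` pseudoexpectation validates a pigeonhole frame of degree `t` with `2t ≤ d`:
polynomials `P i h` (`i < N` pigeons, `h < K` holes, `K < N`) of degree `≤ t` with Booleanity
`Ẽ[P²] = Ẽ[P]`, clash `Ẽ[P i h · P j h] = 0` (`i ≠ j`) and totality `1 ≤ Ẽ[Σ_h P i h]`.
(These expectation-level forms follow from the identity forms `SatisfiesIdentity d Ẽ (P² - P)`,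
`SatisfiesIdentity d Ẽ (P i h · P j h)` and from any Positivstellensatz certificate
`Σ_h P i h - 1 = SOS + ideal` of fitting degree.) Proof: sum `pseudoexpectation_one_sub_sum_nonneg`
over the holes (`Σ_{i,h} Ẽ[P i h] ≤ K`) and totality over the pigeons (`≥ N`).
[Grigoriev–Hirsch–Pasechnik 2002, §4 (PHP has bounded-degree static LS₊ refutations)] [folklore] -/
theorem not_phpFrame_of_isPseudoexpectation {N K d t : ℕ} (Ex : MvPolynomial ℕ ℝ →ₗ[ℝ] ℝ)
    (hE : IsPseudoexpectation d Ex) (P : Fin N → Fin K → MvPolynomial ℕ ℝ)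
    (hdeg : ∀ i h, (P i h).totalDegree ≤ t) (h2t : 2 * t ≤ d)
    (hbool : ∀ i h, Ex (P i h * P i h) = Ex (P i h))
    (hclash : ∀ h i j, i ≠ j → Ex (P i h * P j h) = 0)
    (htot : ∀ i, 1 ≤ Ex (∑ h, P i h)) (hNK : K < N) : False := by
  classical
  -- holes: `Σ_h Σ_i Ẽ[P i h] ≤ K`
  have hholes : ∑ h : Fin K, ∑ i : Fin N, Ex (P i h) ≤ (K : ℝ) := by
    have h1 : ∀ h : Fin K, ∑ i : Fin N, Ex (P i h) ≤ 1 := by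
      intro h
      have := pseudoexpectation_one_sub_sum_nonneg Ex hE (fun i => P i h) (fun i => hdeg i h)
        h2t (fun i => hbool i h) (fun i j hij => hclash h i j hij)
      linarith
    calc ∑ h : Fin K, ∑ i : Fin N, Ex (P i h) ≤ ∑ _h : Fin K, (1 : ℝ) :=
          Finset.sum_le_sum fun h _ => h1 h
      _ = K := by simp
  -- pigeons: `N ≤ Σ_i Σ_h Ẽ[P i h]`
  have hpigeons : (N : ℝ) ≤ ∑ i : Fin N, ∑ h : Fin K, Ex (P i h) := by
    calc (N : ℝ) = ∑ _i : Fin N, (1 : ℝ) := by simp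
      _ ≤ ∑ i : Fin N, ∑ h : Fin K, Ex (P i h) :=
          Finset.sum_le_sum fun i _ => by rw [← map_sum]; exact htot i
  rw [Finset.sum_comm] at hpigeons
  have hlt : (K : ℝ) < N := by exact_mod_cast hNK
  linarith

end CountingFrameBarrier

end Summit.PneNP.PneNP.Theorems
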